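import Literature.InformationTheory.QuantumCodes.QuantumExpanderNoisySyndromeCluster
import HarnessLib

/-!
# Small-set-flip with a NOISY syndrome (Fawzi–Grospellier–Leverrier, FOCS 2018), part 7: Lemma 26 assembled (deterministic
# form) — the single entry point for the proof of Theorem 13

Index of sources: `[cite: FawziGrospellierLeverrier2018FT]` = Fawzi–Grospellier–Leverrier, FOCS 2018 / arXiv:1808.03821, §3.4 Lemma 26 (p0020
L41-44: "If `|MaxConn_{α₀}(E ∪ D)| ≤ γ₀√n` then there is a reduced error `E_ls` equivalent to the remaining error `E ⊕ Ê` such that for all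
`S ⊆ E_ls` there is a `c₀`-witness for `(S, D)`"), Def. 23–24, and the first lines of the proof of Thm. 13 (p0021 L23-33: "for a fixed `W`,
`W` is a witness for `(S,D)` implies that there is a set `T ⊆ Γ_X(W)` such that `|W| ≤ c₀|T|` and `T ⊆ D` … the cardinality of `Γ_X(W)` is
upper bounded by `d_B|W|`").

Topic `Literature/InformationTheory/QuantumCodes` (venture QEC, row 04 `prover-qec-type-04` gen 8, line L-SSF-NOISY = PARTITION v2.48 D50.L8,
node N15). Parts 4–6 proved the two halves of Lemma 26 and recast its percolation hypothesis as the tree's event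
`¬ HasAlphaCluster 𝒢 α₀ (t+1) (E.disjSum D)`. This file only ASSEMBLES: existence of the minimum-weight word `E_ls` with the residual's
syndrome, both halves under the one event, and the check-neighbourhood bound `|Γ_X(W)| ≤ max Δ·|W|` used in the union bound of Thm. 13.

* `exists_minWeight_sameSyndrome` — a minimum-weight word with a prescribed syndrome exists (finite minimisation);
* `card_checkNbhd_le` — `|Γ_X(W)| ≤ max(Δ_A, Δ_B)·|W|` for the `σ_X`-checks of `Q_G`;
* ★ `fgl18b_lemma26` — for every small-set-flip decoder of the tree (`0 < κ`, `2κ < min Δ·β₁`), every `(E, D)` outside the event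
  `HasAlphaCluster 𝒢 α₀ (t+1) (E ⊔ D)` (`α₀ = κ/(2(κ + max Δ))`, `max Δ·t ≤ min Δ·min(γ_A n_A, γ_B n_B)`; `δ < 1/16`): there is a word
  `E_ls`, of minimum weight among the words with the syndrome of `E ⊕ Ê` (hence reduced), with `E_ls ≡ E ⊕ Ê` modulo `C_Z^⊥`, such
  that every check-closed `W ⊆ supp E_ls` — in particular the printed witness of any `S ⊆ E_ls` — has `|W| ≤ c₀·|D ∩ Γ_X(W)|`,
  `c₀ = 4/(min Δ·β₁ − 2κ)`.

WHAT REMAINS FOR THM. 13 (not here): Lemma 27 = the tree's `sum_hasAlphaCluster_le_geometric` on `𝒢` (needs only a degree bound of the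
chosen `𝒢` and a locally stochastic law of `E ⊔ D`), and the union bound over witnesses (`𝓜(S)` counting, Gottesman 2014 Lemma 2, with the
binomial-entropy estimate). Column word: PROVED (kernel); no definitions, no named facts.
-/

namespace Literature.InformationTheory.QuantumCodes

open Finset Matrix Literature.Probability.LatticeModels

namespace QuantumExpander

variable {A B : Type*} [Fintype A] [Fintype B] [DecidableEq A] [DecidableEq B]

/-- A minimum-weight word with a prescribed (attained) syndrome exists ("We define `E_ls` as one of the minimal weight errors whose
syndrome is the same than the syndrome of the error `E ⊕ Ê`"). [cite: FawziGrospellierLeverrier2018FT, proof of Lemma 26 (arXiv p0020 L45-46)] -/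
theorem exists_minWeight_sameSyndrome {C Q : Type*} [Fintype C] [Fintype Q] [DecidableEq C] [DecidableEq Q]
    (Hs : Matrix C Q (ZMod 2)) (x : Q → ZMod 2) :
    ∃ eLs : Q → ZMod 2, Hs *ᵥ eLs = Hs *ᵥ x ∧
      ∀ v : Q → ZMod 2, Hs *ᵥ v = Hs *ᵥ eLs → hammingNorm eLs ≤ hammingNorm v := by
  classical
  set S : Finset (Q → ZMod 2) := univ.filter fun v => Hs *ᵥ v = Hs *ᵥ x with hS
  have hne : S.Nonempty := ⟨x, by rw [hS, Finset.mem_filter]; exact ⟨Finset.mem_univ _, rfl⟩⟩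
  obtain ⟨eLs, heLs, hmin⟩ := Finset.exists_min_image S hammingNorm hne
  rw [hS, Finset.mem_filter] at heLs
  refine ⟨eLs, heLs.2, fun v hv => hmin v ?_⟩
  rw [hS, Finset.mem_filter]
  exact ⟨Finset.mem_univ _, by rw [hv, heLs.2]⟩

/-- **`|Γ_X(W)| ≤ max(Δ_A, Δ_B)·|W|`**: every qubit of `Q_G` lies in at most `max Δ` of the `σ_X`-checks ("the cardinality of `Γ_X(W)`
is upper bounded by `d_B|W|`"). [cite: FawziGrospellierLeverrier2018FT, proof of Thm 13 (arXiv p0021 L31-33)] -/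
theorem card_checkNbhd_le (H : Matrix B A (ZMod 2)) {dA dB : ℕ} (hreg : IsBiregular H dA dB)
    (W : Finset ((A × A) ⊕ (B × B))) :
    (univ.filter fun c : A × B => ∃ q ∈ W, expanderHX H c q ≠ 0).card ≤ max dA dB * W.card := by
  classical
  have hcover : (univ.filter fun c : A × B => ∃ q ∈ W, expanderHX H c q ≠ 0)
      ⊆ W.biUnion fun q => univ.filter fun c : A × B => expanderHX H c q ≠ 0 := by
    intro c hc
    rw [Finset.mem_filter] at hc
    obtain ⟨q, hq, hcq⟩ := hc.2
    exact Finset.mem_biUnion.2 ⟨q, hq, Finset.mem_filter.2 ⟨Finset.mem_univ _, hcq⟩⟩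
  refine (Finset.card_le_card hcover).trans (Finset.card_biUnion_le.trans ?_)
  have hcol : ∀ q ∈ W, (univ.filter fun c : A × B => expanderHX H c q ≠ 0).card ≤ max dA dB := by
    intro q _
    have h := hammingNorm_expanderHX_mulVec_le_max H hreg (flipVec {q})
    rw [hammingNorm_flipVec, Finset.card_singleton, mul_one] at h
    have hset : (univ.filter fun c : A × B => expanderHX H c q ≠ 0)
        = univ.filter fun c : A × B => (expanderHX H *ᵥ flipVec {q}) c ≠ 0 := by
      ext c
      simp only [Finset.mem_filter, Finset.mem_univ, true_and, Matrix.mulVec, dotProduct, flipVec,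
        Finset.mem_singleton, mul_ite, mul_one, mul_zero, Finset.sum_ite_eq', Finset.mem_univ, if_true]
    rw [hset]
    exact h
  calc ∑ q ∈ W, (univ.filter fun c : A × B => expanderHX H c q ≠ 0).card
      ≤ ∑ _q ∈ W, max dA dB := Finset.sum_le_sum hcol
    _ = max dA dB * W.card := by rw [Finset.sum_const, smul_eq_mul, mul_comm]

/-- ★ **FGL18b Lemma 26, assembled (deterministic form).** Let `G` be `(Δ_A, Δ_B)`-biregular (`Δ ≥ 1`), `(γ_A, δ_A, γ_B, δ_B)`-expanding with
`0 ≤ δ_A, δ_B` and `δ = max(δ_A, δ_B) < 1/16` (so also `< 1/6`), `Dec` ANY small-set-flip decoder of the tree with threshold `κ` (`0 < κ`,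
`2κ < min Δ·β₁`, `β₁ = 1 − 16δ`), `𝒢` any graph on `V ⊔ C_X` containing the qubit adjacency of `checkGraph (H_X; H_Z)` and the incidences of
`H_X`, `α₀ = κ/(2(κ + max Δ))`, `t` with `max Δ·t ≤ min Δ·min(γ_A n_A, γ_B n_B)` (printed `γ₀√n`). For every qubit error `E` and syndrome error
`D` OUTSIDE the event `HasAlphaCluster 𝒢 α₀ (t+1) (E ⊔ D)` ("`MaxConn_{α₀}(E ∪ D) ≤ γ₀√n`"), there is `E_ls` with: `σ_X(E_ls) = σ_X(E ⊕ Ê)`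
and minimum weight among such words; `E_ls ≡ E ⊕ Ê` modulo `C_Z^⊥`; and every `W ⊆ supp E_ls` closed in `supp E_ls` for the check-adjacency
(the printed `c₀`-witness of any `S ⊆ E_ls`: the components of `E_ls` meeting `S`) satisfies `|W| ≤ c₀·|D ∩ Γ_X(W)|`, `c₀ = 4/(min Δ·β₁ − 2κ)`.
[cite: FawziGrospellierLeverrier2018FT, Lemma 26 (arXiv p0020 L41-44) and its proof (p0020 L45 – p0021 L9)] -/
theorem fgl18b_lemma26 (H : Matrix B A (ZMod 2)) {dA dB : ℕ} {γA δA γB δB : ℝ}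
    (hreg : IsBiregular H dA dB) (hexp : IsLeftRightExpanding H dA dB γA δA γB δB)
    (hdA : 0 < dA) (hdB : 0 < dB) (hδA : 0 ≤ δA) (hδB : 0 ≤ δB)
    {κ : ℝ} (hκ0 : 0 < κ) (hκ1 : 2 * κ < ((min dA dB : ℕ) : ℝ) * (1 - 16 * max δA δB))
    (G' : SimpleGraph (((A × A) ⊕ (B × B)) ⊕ (A × B)))
    (hlift : ∀ q q', (checkGraph (Matrix.fromRows (expanderHX H) (expanderHZ H))).Adj q q' →
      G'.Adj (Sum.inl q) (Sum.inl q'))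
    (hinc : ∀ c q, expanderHX H c q ≠ 0 → G'.Adj (Sum.inl q) (Sum.inr c))
    (Dec : Decoder (A × B → ZMod 2) ((A × A) ⊕ (B × B) → ZMod 2))
    (hDec : IsSSFDecoder κ (expanderHX H) (expanderHZ H) Dec)
    (E : Finset ((A × A) ⊕ (B × B))) (D : Finset (A × B))
    {t : ℕ} (ht : ((max dA dB : ℕ) : ℝ) * t ≤ ((min dA dB : ℕ) : ℝ) * min (γA * Fintype.card A) (γB * Fintype.card B))
    (hno : ¬ HasAlphaCluster G' (κ / (2 * (κ + ((max dA dB : ℕ) : ℝ)))) (t + 1) (E.disjSum D)) :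
    ∃ eLs : (A × A) ⊕ (B × B) → ZMod 2,
      expanderHX H *ᵥ eLs = expanderHX H *ᵥ (flipVec E + Dec (expanderHX H *ᵥ flipVec E + flipVec D)) ∧
      (∀ v : (A × A) ⊕ (B × B) → ZMod 2, expanderHX H *ᵥ v = expanderHX H *ᵥ eLs →
        hammingNorm eLs ≤ hammingNorm v) ∧
      eLs + (flipVec E + Dec (expanderHX H *ᵥ flipVec E + flipVec D)) ∈ rowSpace (expanderHZ H) ∧
      ∀ W : Finset ((A × A) ⊕ (B × B)), W ⊆ supp eLs →
        (∀ q ∈ W, ∀ q' ∈ supp eLs, ∀ c, expanderHX H c q ≠ 0 → expanderHX H c q' ≠ 0 → q' ∈ W) →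
        (W.card : ℝ) ≤ 4 / (((min dA dB : ℕ) : ℝ) * (1 - 16 * max δA δB) - 2 * κ)
          * ((D ∩ univ.filter fun c => ∃ q ∈ W, expanderHX H c q ≠ 0).card : ℝ) := by
  classical
  obtain ⟨eLs, hsyn, hmin⟩ :=
    exists_minWeight_sameSyndrome (expanderHX H) (flipVec E + Dec (expanderHX H *ᵥ flipVec E + flipVec D))
  refine ⟨eLs, hsyn, hmin, ?_, fun W hWsub hWX => ?_⟩
  · -- the first half of Lemma 26 (part 4) under the event, via the bridge of part 6
    have hδ0 : 0 ≤ max δA δB := le_max_of_le_left hδA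
    have hδ16 : max δA δB < 1 / 16 := by
      have hdm' : (0 : ℝ) < ((min dA dB : ℕ) : ℝ) := by exact_mod_cast lt_min hdA hdB
      by_contra hge
      push Not at hge
      have : ((min dA dB : ℕ) : ℝ) * (1 - 16 * max δA δB) ≤ 0 :=
        mul_nonpos_of_nonneg_of_nonpos hdm'.le (by linarith)
      linarith
    have hδA' : δA < 1 / 6 := by linarith [le_max_left δA δB]
    have hδB' : δB < 1 / 6 := by linarith [le_max_right δA δB]
    refine fgl18b_lemma26_equiv H hreg hexp hdA hdB hδA hδA' hδB hδB' hκ0 Dec hDec E D eLs hsyn hmin ?_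
    intro K hK hineq
    have hdM0 : (0 : ℝ) ≤ ((max dA dB : ℕ) : ℝ) := Nat.cast_nonneg _
    have hdM1 : (1 : ℝ) ≤ ((max dA dB : ℕ) : ℝ) := by exact_mod_cast le_trans hdA (le_max_left _ _)
    have hmM : ((min dA dB : ℕ) : ℝ) ≤ ((max dA dB : ℕ) : ℝ) := by exact_mod_cast min_le_max
    have hpos : (0 : ℝ) < 2 * (κ + ((max dA dB : ℕ) : ℝ)) := by positivity
    have hα : κ / (2 * (κ + ((max dA dB : ℕ) : ℝ)))
          * ((K.card : ℝ) + (D ∩ univ.filter fun c => ∃ q ∈ K, expanderHX H c q ≠ 0).card)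
        ≤ ((E ∩ K).card : ℝ) + (D ∩ univ.filter fun c => ∃ q ∈ K, expanderHX H c q ≠ 0).card := by
      rw [div_mul_eq_mul_div, div_le_iff₀ hpos]
      linarith
    have hle := SmallSetFlip.card_le_of_not_hasAlphaCluster_mixed hlift hinc hno K hK hα
    have hKt : (K.card : ℝ) ≤ t := by exact_mod_cast le_trans (Nat.le_add_right _ _) hle
    -- `|K| ≤ t ≤ (min Δ/max Δ)·min(γn) ≤ min(γn)`
    have hmin0 : 0 ≤ min (γA * Fintype.card A) (γB * Fintype.card B) := by
      by_contra hneg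
      push Not at hneg
      have h1 : ((min dA dB : ℕ) : ℝ) * min (γA * Fintype.card A) (γB * Fintype.card B) < 0 :=
        mul_neg_of_pos_of_neg (by exact_mod_cast lt_min hdA hdB) hneg
      have h2 : (0 : ℝ) ≤ ((max dA dB : ℕ) : ℝ) * t := by positivity
      linarith
    nlinarith [hKt, ht, hmM, hdM1, hmin0]
  · exact fgl18b_lemma26_witness_of_not_hasAlphaCluster H hreg hexp hdA hdB hδA hδB hκ0 hκ1 G' hlift hinc Dec hDec
      E D ht hno eLs hsyn hmin W hWsub hWX

end QuantumExpander

end Literature.InformationTheory.QuantumCodes
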